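/-
Copyright (c) 2026 the pub-hodgecm-mathlib formalisation cell (harness21).  Prover seat hodgecm-mathlib-LH10-p01 (g10): road «M6 ∕ F3 TOT-Λ BY OVER-ORDERS»
(LEAD T14-66; SIG-F3-5 v1 6925585c (S2) «frame dictionary», carve (c5-i); (c8) pen F0P3a-p04 (g30) memo C8 v1 bca68c90 §1 (P1)(P3)), 2026-09-03: the MODEL-FREE matrix
half of the frame dictionary — what the block frame `φ (h, s) = c·[h ⊕ s]·c⁻¹` of ★ (O-5) feeds into ★ (D3) `TypeTwoCommutantBridge.exists_algHom_prod`.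
-/
import Literature.NumberTheory.Rogawski1990.EndoscopicBlockFrameAlgHom   -- ★ (O-5) p852929 (this seat): `exists_algHom_blockFrame` (the frame shape assumed here as `hφ`); brings ★ `endoPerm` and its simp lemmas
import Mathlib.LinearAlgebra.Matrix.Charpoly.Coeff
import HarnessLib

/-!
# The block frame `φ (h, s) = c·[h ⊕ s]·c⁻¹`: characteristic polynomial, eigenline, cyclic vector, and the Eisenstein irreducibility

Topic `NumberTheory/Rogawski1990`; namespace `Literature.NumberTheory.Rogawski1990`.  THEOREMS ONLY (no definition, no instance, no notation, no named fact, no `sorry`).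
Cell `pub/hodgecm-mathlib` (D-0151), crux H413 = `stmt-HodgeConjecture-24833`; road M6 → F3 «TOT-Λ by over-orders», step (S2) of SIG-F3-5 v1: the Eisenstein data
`(g Θ u α β a b)` of ★ (W1) `ncard_vertex_rowZero_eq_of_total`'s `hT` binder, read through the block frame `φ` of ★ (O-5) `exists_algHom_blockFrame`, must supply the
hypotheses of ★ (D3) `exists_algHom_prod` ∕ `hstar_of_algHom_prod` at `τ := φ (g, u)` (`hfτ`, the cyclic vector `hK`, `hirr`, `hχu`) and the eigenline `x₀` of the ★ F4 gates.
Everything here is MODEL-FREE linear algebra over a field `K` (for (E) a valued field); the choice of the quadratic model field `K₂ ∋ λ` is the other half of (S2).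

* §1 (P1) `charpoly_blockFrame`: `(φ (h, s)).charpoly = h.charpoly * (X − C s)`; (P0) `aeval_blockFrame_cubic_eq_zero`: the cubic `(X − u)(X² − (tr g)X + det g)` kills
  `φ (g, u)` — ★ (D3)'s `hfτ` with `t := g.trace`, `D := g.det`; `det_smul_one_sub_eq_eval_charpoly`: `det (u•1 − g) = u² − (tr g)u + det g` (the `n′` of the Eisenstein frame).
* §2 (P3) `blockFrame_mulVec_frameVector`: `φ (h, s) *ᵥ x₀ = s • x₀` for `x₀ := c *ᵥ e₂` (`e₂ = Pi.single (endoPerm (inr 0)) 1`), and `x₀ ≠ 0`.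
* §3 (K) `det_krylov_blockFrame`: for `w₀ := c *ᵥ (e₁ + e₂)`, `det [w₀ | τw₀ | τ²w₀] = −det c · h₁₀ · (s² − (tr h)s + det h)` (`τ = φ (h, s)`), hence
  `isUnit_det_krylov_blockFrame`: `w₀` is cyclic as soon as `h₁₀ ≠ 0` and `s` is not a root of `h.charpoly` — ★ (D3)'s ∕ ★ F3-2b's `hK`.
* §4 (E) `ne_zero_of_eisenstein`: over a valued field, `v d = v ϖ < 1` a uniformiser value (`v x ≤ 1 → v x < 1 → v x ≤ v ϖ`) and `v t < 1` ⇒ `x² − t x + d ≠ 0` for all `x`;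
  `forall_charpoly_ne_zero_of_eisensteinData`: for `Θ = α•1 + β•g` with `v Θ.det = v ϖ`, `v Θ.trace < 1`: `β ≠ 0`, `∀ x, x² − (tr g)x + det g ≠ 0` (★ (D3)'s `hirr`, `hχu`),
  and `g 1 0 ≠ 0` (so §3 applies with `h := g`).

References: [Rogawski1990] J. Rogawski, *Automorphic representations of unitary groups in three variables*, Ann. of Math. Stud. 123 (1990), §4.8 Case (a) p. 53 (the
endoscopic block embedding), §4.9 p. 55 (type-(2) elements: eigenvalue `u`, quadratic block); [HornJohnson2013] R. Horn, C. Johnson, *Matrix Analysis* (2nd ed. 2013),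
§3.2.4 (cyclic vectors ∕ non-derogatory matrices), §1.3 (similarity invariance of the characteristic polynomial); [SerreLocalFields1979] J.-P. Serre, *Local Fields*,
GTM 67 (1979), Ch. I §6 Prop. 17 (Eisenstein polynomials are irreducible); [Lang2002] S. Lang, *Algebra* (3rd ed. 2002), Ch. XIV §3 (characteristic polynomial of a block
matrix, Cayley–Hamilton).
-/

set_option autoImplicit false

open Polynomial Matrix

namespace Literature.NumberTheory.Rogawski1990

section Frame

variable {K : Type*} [Field K] (c : GL (Fin 3) K) (φ : (Matrix (Fin 2) (Fin 2) K × K) →ₐ[K] Matrix (Fin 3) (Fin 3) K)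
  (hφ : ∀ (g : Matrix (Fin 2) (Fin 2) K) (u : K),
    φ (g, u) = (c : Matrix (Fin 3) (Fin 3) K) * Matrix.reindex endoPerm endoPerm (Matrix.fromBlocks g 0 0 (u • (1 : Matrix (Fin 1) (Fin 1) K))) *
      ((c⁻¹ : GL (Fin 3) K) : Matrix (Fin 3) (Fin 3) K))

/-! ## §1 (P1) The characteristic polynomial of the block frame; (P0) the cubic relation -/

omit c φ hφ in
/-- The `1 × 1` block: `(s • 1 : M₁(K)).charpoly = X − C s`. [cite: Lang2002, Ch. XIV §3] -/
theorem charpoly_smul_one_fin_one (s : K) : (s • (1 : Matrix (Fin 1) (Fin 1) K)).charpoly = X - C s := by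
  have h : s • (1 : Matrix (Fin 1) (Fin 1) K) = Matrix.diagonal fun _ => s := by
    ext i j; fin_cases i; fin_cases j; simp
  rw [h, Matrix.charpoly_diagonal, Fin.prod_univ_one]

include hφ in
/-- **(P1) BLOCK CHARACTERISTIC POLYNOMIAL**: `(φ (h, s)).charpoly = h.charpoly · (X − s)` — conjugation and re-indexing do not change the characteristic polynomial, and a
block-diagonal matrix has the product. [cite: Lang2002, Ch. XIV §3] [cite: HornJohnson2013, §1.3] [cite: Rogawski1990, §4.8 Case (a) p. 53] -/
theorem charpoly_blockFrame (h : Matrix (Fin 2) (Fin 2) K) (s : K) : (φ (h, s)).charpoly = h.charpoly * (X - C s) := by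
  rw [hφ, Matrix.coe_units_inv, Matrix.charpoly_units_conj, Matrix.charpoly_reindex, Matrix.charpoly_fromBlocks_zero₁₂,
    charpoly_smul_one_fin_one]

include hφ in
/-- **(P0) THE CUBIC RELATION** (★ (D3) `exists_algHom_prod`'s `hfτ` at `τ := φ (g, u)`, `t := tr g`, `D := det g`):
`τ³ − (t + u)τ² + (D + t u)τ − u D = 0` (Cayley–Hamilton for `(X − u)(X² − tX + D)`). [cite: Lang2002, Ch. XIV §3] [cite: Rogawski1990, §4.9 p. 55] -/
theorem aeval_blockFrame_cubic_eq_zero (g : Matrix (Fin 2) (Fin 2) K) (u : K) :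
    aeval (φ (g, u)) (C 1 * X ^ 3 + C (-(g.trace + u)) * X ^ 2 + C (g.det + g.trace * u) * X + C (-(u * g.det))) = 0 := by
  have h : C 1 * X ^ 3 + C (-(g.trace + u)) * X ^ 2 + C (g.det + g.trace * u) * X + C (-(u * g.det)) = (φ (g, u)).charpoly := by
    rw [charpoly_blockFrame c φ hφ, Matrix.charpoly_fin_two]
    simp only [map_neg, map_add, map_mul, map_one]
    ring
  rw [h]
  exact Matrix.aeval_self_charpoly _

omit c φ hφ in
/-- `det (u•1 − g) = u² − (tr g)·u + det g` — the Eisenstein frame's `(u•1 − g).det` IS `χ_g(u)` (the `n′`-datum). [cite: Lang2002, Ch. XIV §3] -/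
theorem det_smul_one_sub_eq (g : Matrix (Fin 2) (Fin 2) K) (u : K) : (u • (1 : Matrix (Fin 2) (Fin 2) K) - g).det = u * u - g.trace * u + g.det := by
  rw [Matrix.det_fin_two, Matrix.trace_fin_two, Matrix.det_fin_two]
  simp only [Matrix.sub_apply, Matrix.smul_apply, Matrix.one_apply_eq, Matrix.one_apply_ne (by decide : (0 : Fin 2) ≠ 1),
    Matrix.one_apply_ne (by decide : (1 : Fin 2) ≠ 0), smul_eq_mul, mul_one, mul_zero, zero_sub]
  ring

/-! ## §2 (P3) The eigenline of the block frame -/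

omit c φ hφ in
/-- The `e₂`-column of the re-indexed block matrix is `s·e₂`: `[h ⊕ s] *ᵥ e₂ = s • e₂` (`e₂ = Pi.single (endoPerm (inr 0)) 1`). [cite: Rogawski1990, §4.8 Case (a) p. 53] -/
theorem reindex_fromBlocks_mulVec_single (h : Matrix (Fin 2) (Fin 2) K) (s : K) :
    Matrix.reindex endoPerm endoPerm (Matrix.fromBlocks h 0 0 (s • (1 : Matrix (Fin 1) (Fin 1) K))) *ᵥ Pi.single (endoPerm (Sum.inr 0)) (1 : K) =
      s • Pi.single (endoPerm (Sum.inr 0)) (1 : K) := by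
  rw [Matrix.mulVec_single_one]
  ext i
  simp only [Matrix.col_apply, Matrix.reindex_apply, Matrix.submatrix_apply, Equiv.symm_apply_apply, Pi.smul_apply, smul_eq_mul]
  obtain ⟨x, rfl⟩ := endoPerm.surjective i
  rw [Equiv.symm_apply_apply]
  rcases x with a | b
  · rw [Matrix.fromBlocks_apply₁₂, Matrix.zero_apply, Pi.single_eq_of_ne (fun h => Sum.inl_ne_inr (endoPerm.injective h)), mul_zero]
  · have hb : b = 0 := Subsingleton.elim _ _
    subst hb
    rw [Matrix.fromBlocks_apply₂₂, Matrix.smul_apply, Matrix.one_apply_eq, Pi.single_eq_same, smul_eq_mul]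

include hφ in
/-- **(P3) THE EIGENLINE**: `φ (h, s) *ᵥ x₀ = s • x₀` for `x₀ := c *ᵥ e₂` — the SAME `x₀` for every `(h, s)`, in particular for `τ = φ(g,u)` and for any over-order generator
`τ′ = φ(h′, s′)`. [cite: Rogawski1990, §4.9 p. 55] [cite: HornJohnson2013, §1.3] -/
theorem blockFrame_mulVec_frameVector (h : Matrix (Fin 2) (Fin 2) K) (s : K) :
    φ (h, s) *ᵥ ((c : Matrix (Fin 3) (Fin 3) K) *ᵥ Pi.single (endoPerm (Sum.inr 0)) (1 : K)) =
      s • ((c : Matrix (Fin 3) (Fin 3) K) *ᵥ Pi.single (endoPerm (Sum.inr 0)) (1 : K)) := by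
  have hcc : ((c⁻¹ : GL (Fin 3) K) : Matrix (Fin 3) (Fin 3) K) * (c : Matrix (Fin 3) (Fin 3) K) = 1 := by
    rw [← Units.val_mul, inv_mul_cancel, Units.val_one]
  rw [hφ, Matrix.mulVec_mulVec, Matrix.mul_assoc ((c : Matrix (Fin 3) (Fin 3) K) * _), hcc, Matrix.mul_one, ← Matrix.mulVec_mulVec,
    reindex_fromBlocks_mulVec_single, Matrix.mulVec_smul]

omit φ hφ in
/-- The frame vector `x₀ = c *ᵥ e₂` is non-zero (`c` invertible). [cite: HornJohnson2013, §1.3] -/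
theorem frameVector_ne_zero : (c : Matrix (Fin 3) (Fin 3) K) *ᵥ Pi.single (endoPerm (Sum.inr 0)) (1 : K) ≠ 0 := by
  intro h
  have h' := congrArg (fun x => ((c⁻¹ : GL (Fin 3) K) : Matrix (Fin 3) (Fin 3) K) *ᵥ x) h
  simp only [Matrix.mulVec_mulVec, ← Units.val_mul, inv_mul_cancel, Units.val_one, Matrix.one_mulVec, Matrix.mulVec_zero] at h'
  exact (one_ne_zero : (1 : K) ≠ 0) (by simpa using congrFun h' (endoPerm (Sum.inr 0)))

/-! ## §3 (K) A cyclic vector for the block frame -/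

omit c φ hφ in
/-- The block matrix on the test vector: `[h ⊕ s]^j *ᵥ (e₁ + e₂)` has `endoPerm (inl a)`-coordinate `(h^j) a 0` and `endoPerm (inr 0)`-coordinate `s^j`.
[cite: HornJohnson2013, §3.2.4] -/
theorem reindex_fromBlocks_pow_mulVec_apply (h : Matrix (Fin 2) (Fin 2) K) (s : K) (j : ℕ) (x : Fin 2 ⊕ Fin 1) :
    ((Matrix.reindex endoPerm endoPerm (Matrix.fromBlocks h 0 0 (s • (1 : Matrix (Fin 1) (Fin 1) K)))) ^ j *ᵥ
        (Pi.single (endoPerm (Sum.inl 0)) (1 : K) + Pi.single (endoPerm (Sum.inr 0)) (1 : K))) (endoPerm x) =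
      Sum.elim (fun a => (h ^ j) a 0) (fun _ => s ^ j) x := by
  have hpow : (Matrix.reindex endoPerm endoPerm (Matrix.fromBlocks h 0 0 (s • (1 : Matrix (Fin 1) (Fin 1) K)))) ^ j =
      Matrix.reindex endoPerm endoPerm (Matrix.fromBlocks (h ^ j) 0 0 (s ^ j • (1 : Matrix (Fin 1) (Fin 1) K))) := by
    induction j with
    | zero => simp [Matrix.fromBlocks_one]
    | succ n ih =>
      rw [pow_succ, ih]
      simp only [Matrix.reindex_apply, Matrix.submatrix_mul_equiv, Matrix.fromBlocks_multiply, Matrix.mul_zero, Matrix.zero_mul, add_zero,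
        zero_add, Matrix.smul_mul, Matrix.mul_smul, Matrix.one_mul, smul_smul, pow_succ, smul_zero, mul_comm s (s ^ n)]
  rw [hpow, Matrix.mulVec_add, Matrix.mulVec_single_one, Matrix.mulVec_single_one]
  simp only [Pi.add_apply, Matrix.col_apply, Matrix.reindex_apply, Matrix.submatrix_apply, Equiv.symm_apply_apply]
  rcases x with a | b
  · rw [Matrix.fromBlocks_apply₁₁, Matrix.fromBlocks_apply₁₂, Matrix.zero_apply, add_zero, Sum.elim_inl]
  · have hb : b = 0 := Subsingleton.elim _ _
    subst hb
    rw [Matrix.fromBlocks_apply₂₁, Matrix.fromBlocks_apply₂₂, Matrix.zero_apply, zero_add, Matrix.smul_apply, Matrix.one_apply_eq, smul_eq_mul,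
      mul_one, Sum.elim_inr]

omit c φ hφ in
/-- **THE KRYLOV DETERMINANT OF THE BLOCK MATRIX**: for `R = [h ⊕ s]` and `v = e₁ + e₂`, `det [v | Rv | R²v] = −h₁₀ · (s² − (tr h)s + det h)` (column-reduce `R²v` by
Cayley–Hamilton; the sign is the parity of `endoPerm`). [cite: HornJohnson2013, §3.2.4] -/
theorem det_krylov_reindex_fromBlocks (h : Matrix (Fin 2) (Fin 2) K) (s : K) :
    (Matrix.of fun i j : Fin 3 => (((Matrix.reindex endoPerm endoPerm (Matrix.fromBlocks h 0 0 (s • (1 : Matrix (Fin 1) (Fin 1) K)))) ^ (j : ℕ) *ᵥ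
        (Pi.single (endoPerm (Sum.inl 0)) (1 : K) + Pi.single (endoPerm (Sum.inr 0)) (1 : K))) i)).det =
      -(h 1 0 * (s * s - h.trace * s + h.det)) := by
  -- the nine entries
  have hent : ∀ (i : Fin 3) (j : Fin 3), (((Matrix.reindex endoPerm endoPerm (Matrix.fromBlocks h 0 0 (s • (1 : Matrix (Fin 1) (Fin 1) K)))) ^ (j : ℕ) *ᵥ
        (Pi.single (endoPerm (Sum.inl 0)) (1 : K) + Pi.single (endoPerm (Sum.inr 0)) (1 : K))) i) =
      Sum.elim (fun a => (h ^ (j : ℕ)) a 0) (fun _ => s ^ (j : ℕ)) (endoPerm.symm i) := by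
    intro i j
    conv_lhs => rw [← endoPerm.apply_symm_apply i]
    exact reindex_fromBlocks_pow_mulVec_apply h s j _
  have h2 : h ^ 2 = h.trace • h - h.det • (1 : Matrix (Fin 2) (Fin 2) K) := by
    have hch := Matrix.aeval_self_charpoly h
    rw [Matrix.charpoly_fin_two] at hch
    simp only [map_add, map_sub, map_mul, aeval_X_pow, aeval_C, aeval_X, Algebra.algebraMap_eq_smul_one, smul_mul_assoc, one_mul] at hch
    rw [sub_add_eq_add_sub, sub_eq_zero] at hch
    rw [← sub_eq_zero]
    rw [← sub_eq_zero] at hch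
    rw [← hch]
    abel_nf
  rw [Matrix.det_fin_three]
  simp only [Matrix.of_apply, hent, endoPerm_symm_zero, endoPerm_symm_one, endoPerm_symm_two, Sum.elim_inl, Sum.elim_inr,
    Fin.val_zero, Fin.val_one, Fin.val_two, pow_zero, pow_one, Matrix.one_apply_eq,
    Matrix.one_apply_ne (by decide : (1 : Fin 2) ≠ 0)]
  rw [h2]
  simp only [Matrix.sub_apply, Matrix.smul_apply, Matrix.one_apply_eq, Matrix.one_apply_ne (by decide : (1 : Fin 2) ≠ 0), smul_eq_mul, mul_one,
    mul_zero, sub_zero]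
  rw [Matrix.trace_fin_two, Matrix.det_fin_two]
  ring

include hφ in
/-- **(K) A CYCLIC VECTOR FOR `τ = φ (h, s)`**: with `w₀ := c *ᵥ (e₁ + e₂)`, `det [w₀ | τw₀ | τ²w₀] = −det c · h₁₀ · (s² − (tr h)s + det h)`; so `w₀` is cyclic (★ (D3)'s ∕
★ F3-2b's `hK`) whenever `h₁₀ ≠ 0` and `χ_h(s) ≠ 0` — both automatic for Eisenstein data (§4). [cite: HornJohnson2013, §3.2.4] [cite: Rogawski1990, §4.9 p. 55] -/
theorem det_krylov_blockFrame (h : Matrix (Fin 2) (Fin 2) K) (s : K) :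
    (Matrix.of fun i j : Fin 3 => (((φ (h, s)) ^ (j : ℕ)) *ᵥ
        ((c : Matrix (Fin 3) (Fin 3) K) *ᵥ (Pi.single (endoPerm (Sum.inl 0)) (1 : K) + Pi.single (endoPerm (Sum.inr 0)) (1 : K)))) i).det =
      -((c : Matrix (Fin 3) (Fin 3) K).det * (h 1 0 * (s * s - h.trace * s + h.det))) := by
  set R : Matrix (Fin 3) (Fin 3) K := Matrix.reindex endoPerm endoPerm (Matrix.fromBlocks h 0 0 (s • (1 : Matrix (Fin 1) (Fin 1) K))) with hR
  set v : Fin 3 → K := Pi.single (endoPerm (Sum.inl 0)) (1 : K) + Pi.single (endoPerm (Sum.inr 0)) (1 : K) with hv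
  have hcc : ((c⁻¹ : GL (Fin 3) K) : Matrix (Fin 3) (Fin 3) K) * (c : Matrix (Fin 3) (Fin 3) K) = 1 := by
    rw [← Units.val_mul, inv_mul_cancel, Units.val_one]
  have hpow : ∀ j : ℕ, (φ (h, s)) ^ j = (c : Matrix (Fin 3) (Fin 3) K) * R ^ j * ((c⁻¹ : GL (Fin 3) K) : Matrix (Fin 3) (Fin 3) K) := by
    intro j
    induction j with
    | zero => rw [pow_zero, pow_zero, Matrix.mul_one, ← Units.val_mul, mul_inv_cancel, Units.val_one]
    | succ n ih =>
      rw [pow_succ, ih, hφ, ← hR, pow_succ]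
      simp only [Matrix.mul_assoc]
      rw [← Matrix.mul_assoc ((c⁻¹ : GL (Fin 3) K) : Matrix (Fin 3) (Fin 3) K) (c : Matrix (Fin 3) (Fin 3) K), hcc, Matrix.one_mul]
  have hcol : ∀ j : ℕ, ((φ (h, s)) ^ j) *ᵥ ((c : Matrix (Fin 3) (Fin 3) K) *ᵥ v) = (c : Matrix (Fin 3) (Fin 3) K) *ᵥ (R ^ j *ᵥ v) := by
    intro j
    rw [hpow, Matrix.mulVec_mulVec, Matrix.mul_assoc ((c : Matrix (Fin 3) (Fin 3) K) * R ^ j), hcc, Matrix.mul_one, ← Matrix.mulVec_mulVec]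
  have hmat : (Matrix.of fun i j : Fin 3 => (((φ (h, s)) ^ (j : ℕ)) *ᵥ ((c : Matrix (Fin 3) (Fin 3) K) *ᵥ v)) i) =
      (c : Matrix (Fin 3) (Fin 3) K) * Matrix.of fun i j : Fin 3 => (R ^ (j : ℕ) *ᵥ v) i := by
    ext i j
    rw [Matrix.of_apply, hcol]
    simp only [Matrix.mulVec, dotProduct, Matrix.mul_apply, Matrix.of_apply]
  rw [hmat, Matrix.det_mul, hR, hv, det_krylov_reindex_fromBlocks]
  ring

include hφ in
/-- `w₀ := c *ᵥ (e₁ + e₂)` is a cyclic vector for `φ (h, s)` if `h₁₀ ≠ 0` and `s² − (tr h)s + det h ≠ 0`. [cite: HornJohnson2013, §3.2.4] -/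
theorem isUnit_det_krylov_blockFrame (h : Matrix (Fin 2) (Fin 2) K) (s : K) (h10 : h 1 0 ≠ 0) (hs : s * s - h.trace * s + h.det ≠ 0) :
    IsUnit (Matrix.of fun i j : Fin 3 => (((φ (h, s)) ^ (j : ℕ)) *ᵥ
        ((c : Matrix (Fin 3) (Fin 3) K) *ᵥ (Pi.single (endoPerm (Sum.inl 0)) (1 : K) + Pi.single (endoPerm (Sum.inr 0)) (1 : K)))) i).det := by
  rw [det_krylov_blockFrame c φ hφ]
  refine (neg_ne_zero.2 (mul_ne_zero ?_ (mul_ne_zero h10 hs))).isUnit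
  exact (Matrix.isUnits_det_units c).ne_zero

end Frame

/-! ## §4 (E) Irreducibility from the Eisenstein data -/

section Eisenstein

variable {K : Type*} [Field K] [Valued K (WithZero (Multiplicative ℤ))]

/-- In a valued field, an EISENSTEIN quadratic has no root: if `ϖ ≠ 0`, `v ϖ < 1`, every `x` with `v x < 1` has `v x ≤ v ϖ` (uniformiser gap), `v t < 1` and
`v d = v ϖ`, then `x² − t x + d ≠ 0` for every `x` (`v x ≤ v ϖ`: the constant term dominates; `v x ≥ 1`: the square dominates). [cite: SerreLocalFields1979, Ch. I §6 Prop. 17] -/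
theorem ne_zero_of_eisenstein {ϖ : K} (hϖ0 : ϖ ≠ 0) (hϖ1 : Valued.v ϖ < 1) (hgap : ∀ x : K, Valued.v x < 1 → Valued.v x ≤ Valued.v ϖ)
    {t d : K} (ht : Valued.v t < 1) (hd : Valued.v d = Valued.v ϖ) (x : K) : x * x - t * x + d ≠ 0 := by
  have hv0 : Valued.v ϖ ≠ 0 := (Valuation.ne_zero_iff _).2 hϖ0
  intro hx
  rcases lt_or_ge (Valued.v x) 1 with hlt | hge
  · -- `v x ≤ v ϖ`: the constant term dominates
    have hxϖ : Valued.v x ≤ Valued.v ϖ := hgap x hlt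
    have h1 : Valued.v (x * x - t * x) < Valued.v d := by
      refine lt_of_le_of_lt (Valuation.map_sub _ _ _) (max_lt ?_ ?_)
      · rw [map_mul, hd]
        calc Valued.v x * Valued.v x ≤ Valued.v ϖ * Valued.v ϖ := mul_le_mul' hxϖ hxϖ
          _ < Valued.v ϖ * 1 := (mul_lt_mul_iff_right₀ (zero_lt_iff.2 hv0)).2 hϖ1
          _ = Valued.v ϖ := mul_one _
      · rw [map_mul, hd, mul_comm]
        calc Valued.v x * Valued.v t < Valued.v ϖ * 1 := mul_lt_mul_of_le_of_lt_of_nonneg_of_pos hxϖ ht zero_le (zero_lt_iff.2 hv0)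
          _ = Valued.v ϖ := mul_one _
    have h2 : Valued.v (x * x - t * x + d) = Valued.v d := Valuation.map_add_eq_of_lt_right _ h1
    rw [hx, map_zero, hd] at h2
    exact hv0 h2.symm
  · -- `v x ≥ 1`: the square dominates
    have hx0 : Valued.v x ≠ 0 := fun h => by rw [h] at hge; exact not_lt.2 hge zero_lt_one
    have h1 : Valued.v (-(t * x) + d) < Valued.v (x * x) := by
      refine lt_of_le_of_lt (Valuation.map_add _ _ _) (max_lt ?_ ?_)
      · rw [Valuation.map_neg, map_mul, map_mul, mul_comm]
        calc Valued.v x * Valued.v t < Valued.v x * 1 := (mul_lt_mul_iff_right₀ (zero_lt_iff.2 hx0)).2 ht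
          _ ≤ Valued.v x * Valued.v x := mul_le_mul' le_rfl hge
      · rw [map_mul, hd]
        calc Valued.v ϖ < 1 := hϖ1
          _ ≤ Valued.v x * Valued.v x := one_le_mul hge hge
    have h2 : Valued.v (x * x + (-(t * x) + d)) = Valued.v (x * x) := Valuation.map_add_eq_of_lt_left _ h1
    have h3 : x * x + (-(t * x) + d) = x * x - t * x + d := by ring
    rw [h3, hx, map_zero, map_mul] at h2
    exact hx0 (by simpa using h2.symm)

/-- The uniformiser gap in `ℤᵐ⁰`: `|ϖ| = exp(−1)` ⇒ (`|x| < 1 → |x| ≤ |ϖ|`). [cite: SerreLocalFields1979, Ch. I §6] -/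
theorem v_le_v_of_v_lt_one {ϖ : K} (hϖ : Valued.v ϖ = WithZero.exp (-1 : ℤ)) (x : K) (hx : Valued.v x < 1) : Valued.v x ≤ Valued.v ϖ := by
  have hϖ0 : ϖ ≠ 0 := fun h0 => by rw [h0, map_zero] at hϖ; exact WithZero.coe_ne_zero hϖ.symm
  have hvϖ0 : Valued.v ϖ ≠ 0 := (Valuation.ne_zero_iff _).2 hϖ0
  have h1 : (1 : WithZero (Multiplicative ℤ)) = Valued.v ϖ * WithZero.exp (1 : ℤ) := by rw [hϖ, ← WithZero.exp_add]; norm_num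
  rw [h1] at hx
  exact (WithZero.lt_mul_exp_iff_le hvϖ0).1 hx

/-- **(E) THE EISENSTEIN DATA FORCE A NON-SPLIT, NON-SCALAR BLOCK.**  For `Θ = α•1 + β•g` with `|det Θ| = |ϖ| = exp(−1)` and `|tr Θ| < 1` (the Eisenstein relations of ★ (W1)'s
`hT` binder ∕ ★ F2 `exists_eisensteinData`): (i) `χ_Θ` has no root in `K`; (ii) `β ≠ 0`; (iii) `χ_g(x) = x² − (tr g)x + det g ≠ 0` for every `x ∈ K` — ★ (D3)'s `hirr`, and
`hχu` at `x = u`; (iv) `g₁₀ ≠ 0` (else `g₀₀` would be a root) — the entry §3's cyclic vector needs.  (`χ_Θ(α + βx) = β²·χ_g(x)`.)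
[cite: SerreLocalFields1979, Ch. I §6 Prop. 17] [cite: Rogawski1990, §4.9 p. 55] -/
theorem charpoly_ne_zero_of_eisensteinData {ϖ : K} (hϖ : Valued.v ϖ = WithZero.exp (-1 : ℤ)) {g Θ : Matrix (Fin 2) (Fin 2) K} {α β : K}
    (hΘ : Θ = α • 1 + β • g) (hΘd : Valued.v Θ.det = Valued.v ϖ) (hΘt : Valued.v Θ.trace < 1) :
    (∀ x : K, x * x - Θ.trace * x + Θ.det ≠ 0) ∧ β ≠ 0 ∧ (∀ x : K, x * x - g.trace * x + g.det ≠ 0) ∧ g 1 0 ≠ 0 := by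
  have hϖ0 : ϖ ≠ 0 := fun h0 => by rw [h0, map_zero] at hϖ; exact WithZero.coe_ne_zero hϖ.symm
  have hϖ1 : Valued.v ϖ < 1 := by rw [hϖ, ← WithZero.exp_zero]; exact WithZero.exp_lt_exp.2 (by norm_num)
  have hΘirr : ∀ x : K, x * x - Θ.trace * x + Θ.det ≠ 0 := ne_zero_of_eisenstein hϖ0 hϖ1 (v_le_v_of_v_lt_one hϖ) hΘt hΘd
  -- entries
  have htrΘ : Θ.trace = 2 * α + β * g.trace := by
    rw [hΘ, Matrix.trace_fin_two, Matrix.trace_fin_two]; simp; ring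
  have hdetΘ : Θ.det = α * α + α * β * g.trace + β * β * g.det := by
    rw [hΘ, Matrix.det_fin_two, Matrix.trace_fin_two, Matrix.det_fin_two]; simp; ring
  have hβ : β ≠ 0 := by
    intro hβ0
    -- `Θ = α•1`: `χ_Θ(α) = 0`
    refine hΘirr α ?_
    rw [htrΘ, hdetΘ, hβ0]; ring
  have hg : ∀ x : K, x * x - g.trace * x + g.det ≠ 0 := by
    intro x hx
    refine hΘirr (α + β * x) ?_
    have key : (α + β * x) * (α + β * x) - Θ.trace * (α + β * x) + Θ.det = β * β * (x * x - g.trace * x + g.det) := by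
      rw [htrΘ, hdetΘ]; ring
    rw [key, hx, mul_zero]
  refine ⟨hΘirr, hβ, hg, fun h10 => hg (g 0 0) ?_⟩
  rw [Matrix.trace_fin_two, Matrix.det_fin_two, h10]; ring

end Eisenstein

end Literature.NumberTheory.Rogawski1990
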